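import Summits.CriticalPhenomena.Ising3DConformalLimit.Theses.ArmHyperscaling
import Summits.CriticalPhenomena.Ising3DConformalLimit.Theorems.ArmHyperscalingMergingFloorXorClusterCover
import Summits.CriticalPhenomena.Ising3DConformalLimit.Theorems.ArmHyperscalingMergingFloorXorDisjointClustersBK
import Summits.CriticalPhenomena.Ising3DConformalLimit.Theorems.ArmHyperscalingMergingFloorXorDisphenoidSymmetry
import Summits.CriticalPhenomena.Ising3DConformalLimit.Theorems.ArmHyperscalingMergingFloorXorAssembly
import Summits.CriticalPhenomena.Ising3DConformalLimit.Theorems.ArmHyperscalingMergingFloorXorSwitchObservable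
import HarnessLib

/-!
# Crux `MergingFloor` (stmt-CriticalPhenomena-15592, route ArmHyperscaling) — line `xor-cluster-sign-bk`
# (payload slug `Sketch`): skeleton, v3 (four stubs LANDED; heart reshaped into switch identity + source doubling)

Lead prover-line-stmt-CriticalPhenomena-15592-c1-0, 2026-08-17.  Card:
`Cruxes/MergingFloor/Ideas/xor-cluster-sign-bk.md`.

The overlap field of two independent critical replicas is the cluster-sign field of the SOURCELESS
double random current `T = n̂₁ ∪ n̂₂` (box switching identity, ADC21 (3.7) with `A = B = S`:
`P^{∅,∅}_{Λ_L}[𝓕_S] = (⟨σ_S⟩⁰_{Λ_L})²`).  At the pinched disphenoid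
`X_ε = ((0,0,0),(0,ε,1),(ε,ε,0),(ε,0,1))`, whose lattice approximations at mesh `δ` are
`y₀ = (0,0,0)`, `y₁ = (0,e,n)`, `y₂ = (e,e,0)`, `y₃ = (e,0,n)` with `e = ⌊ε/δ⌋`, `n = ⌊1/δ⌋`
(`latticeApprox` is the coordinatewise floor), write `G_L` for the free box two-point function at
`β_c`, `u_L = G_L(y₀,y₁)G_L(y₂,y₃)`, `w_L = G_L(y₀,y₂)G_L(y₁,y₃)`, `S₄,L = ⟨σ_{y₀}σ_{y₁}σ_{y₂}σ_{y₃}⟩⁰_{Λ_L}`.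
Box level: `S₄,L² = P_L[𝓕_S] ≤ P_L[(y₀↔y₁)∧𝓕_S] + P_L[y₀↔y₃, y₁↔y₂, y₀↮y₁] + P_L[y₀↔y₂, y₁↔y₃, y₀↮y₁]`
(cluster cover) `≤ (3−2c)u_Lw_L + (G_L(y₀,y₃)G_L(y₁,y₂))² + w_L²` (heart (SD) + disjoint-clusters BK
twice); `L → ∞` (`criticalCorr_wellDefined_holds`, free b.c.); then the exact lattice symmetry
`G₀₃G₁₂ = G₀₁G₂₃ = u` and MMS `u ≤ w` give `S₄² − w² ≤ (4−2c)uw`, and GKS II `S₄ ≥ w > 0` gives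
`S₄ − w ≤ (2−c)u`, i.e. `−U₄ = 2u + w − S₄ ≥ c·u` — the crux at `x = X_ε`.

Stubs (registered 2026-08-17): LANDED — `stub_clusterCover` (p162669,
`Theorems/ArmHyperscalingMergingFloorXorClusterCover.lean`), `stub_disjointClustersBK` (p163394,
`Theorems/ArmHyperscalingMergingFloorXorDisjointClustersBK.lean`), `stub_disphenoidSymmetry` (p163768,
`Theorems/ArmHyperscalingMergingFloorXorDisphenoidSymmetry.lean`), `stub_assembly` (the glue; p163985,
`Theorems/ArmHyperscalingMergingFloorXorAssembly.lean`); v3 (reshape of the heart): `stub_switchObservable` (LANDED p164814,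
`Theorems/ArmHyperscalingMergingFloorXorSwitchObservable.lean`: switching with the observable `𝟙[y₀↔y₁]`) and `stub_sourceDoublingSS` (the heart (SD) in SOURCE-DOUBLING
form `⟨σ_S⟩²·P^{S,S}[y₀↔y₁] ≤ (3−2c)uw`, the `d = 3` input) replace v2's `stub_sourceDoubling`, which is
recovered by the proved glue `sourceDoubling_of`. `MergingFloor_proof` concludes the crux BY NAME.
-/

noncomputable section

namespace Summit.CriticalPhenomena.Ising3DConformalLimit.ArmHyperscalingMergingFloorXor

open Literature.Probability.LatticeModels Literature.Probability.Percolation Filter Topology MeasureTheory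
open scoped symmDiff
open Summit.CriticalPhenomena.Ising3DConformalLimit.Theses.ArmHyperscaling (MergingFloor)

/-! ## The one open stub: the heart, in source-doubling form (v3; `stub_switchObservable` LANDED p164814) -/

/-- **(SD) SOURCE DOUBLING at a pinched disphenoid — the heart (open), in switched form.** For some
pinch `ε ∈ (0,1)` and `c > 0`: for all small meshes `δ` and then all large boxes `L`, with
`e = ⌊ε/δ⌋`, `n = ⌊1/δ⌋`, `S = {y₀,y₁,y₂,y₃} = {(0,0,0),(0,e,n),(e,e,0),(e,0,n)}`,
`(⟨σ_S⟩⁰_{Λ_L})² · P^{S,S}_{Λ_L,β_c}[y₀ ↔ y₁] ≤ (3 − 2c) · (G_L(y₀,y₁)G_L(y₂,y₃)) · (G_L(y₀,y₂)G_L(y₁,y₃))`: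
giving BOTH currents the four sources multiplies the long connection probability
`P^{S,∅}[y₀ ↔ y₁] = G_L(y₀,y₁)G_L(y₂,y₃)/⟨σ_S⟩` (exact) by at most `≈ (3−2c)·G₀₂G₁₃/⟨σ_S⟩ ≤ 3 − 2c`
(union-bound value `4`; in `d ≥ 5` the factor tends to `4`, so this is the `d = 3` input).
Equivalently (general switching twice): `P^{01,01}_L[y₂ ∈ C(y₀) ∧ y₃ ∈ C(y₀)] ≤ (3−2c−o(1))·G₀₂G₁₃`,
a two-point density ceiling for the doubly-sourced cluster near its sources. MC calibration kit
j026387. [difficulty: open — the `d = 3` input] -/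
theorem stub_sourceDoublingSS : ∃ ε : ℝ, 0 < ε ∧ ε < 1 ∧ ∃ c : ℝ, 0 < c ∧
    ∀ᶠ δ in 𝓝[>] (0:ℝ), ∀ᶠ L : ℕ in atTop,
      isingCorr (zdGraph 3) (box 3 L) (criticalBeta 3) 0 .free
            ({![0, 0, 0], ![0, ⌊ε / δ⌋, ⌊1 / δ⌋], ![⌊ε / δ⌋, ⌊ε / δ⌋, 0], ![⌊ε / δ⌋, 0, ⌊1 / δ⌋]} :
              Finset (Site 3)) ^ 2 *
          (sourcedDoubleCurrentLaw 3 L (criticalBeta 3)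
              ({![0, 0, 0], ![0, ⌊ε / δ⌋, ⌊1 / δ⌋], ![⌊ε / δ⌋, ⌊ε / δ⌋, 0], ![⌊ε / δ⌋, 0, ⌊1 / δ⌋]} :
                Finset (Site 3))
              ({![0, 0, 0], ![0, ⌊ε / δ⌋, ⌊1 / δ⌋], ![⌊ε / δ⌋, ⌊ε / δ⌋, 0], ![⌊ε / δ⌋, 0, ⌊1 / δ⌋]} :
                Finset (Site 3))).real
            (openConn (![0, 0, 0] : Site 3) ![0, ⌊ε / δ⌋, ⌊1 / δ⌋]) ≤
        (3 - 2 * c) *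
          (isingTwoPoint (zdGraph 3) (box 3 L) (criticalBeta 3) 0 .free ![0, 0, 0] ![0, ⌊ε / δ⌋, ⌊1 / δ⌋] *
            isingTwoPoint (zdGraph 3) (box 3 L) (criticalBeta 3) 0 .free ![⌊ε / δ⌋, ⌊ε / δ⌋, 0] ![⌊ε / δ⌋, 0, ⌊1 / δ⌋]) *
          (isingTwoPoint (zdGraph 3) (box 3 L) (criticalBeta 3) 0 .free ![0, 0, 0] ![⌊ε / δ⌋, ⌊ε / δ⌋, 0] *
            isingTwoPoint (zdGraph 3) (box 3 L) (criticalBeta 3) 0 .free ![0, ⌊ε / δ⌋, ⌊1 / δ⌋] ![⌊ε / δ⌋, 0, ⌊1 / δ⌋]) := by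
  sorry

/-- Eventually every point of a finite set lies in the box. [folklore] -/
theorem eventually_subset_box (A : Finset (Site 3)) : ∀ᶠ L : ℕ in atTop, A ⊆ box 3 L := by
  obtain ⟨L₀, hL₀⟩ := exists_forall_subset_box 3 A
  filter_upwards [eventually_ge_atTop L₀] with L hL using hL₀ L hL

/-- **Glue (proved): the switched heart gives the heart.** `stub_switchObservable` turns the source-doubling
form `(⟨σ_S⟩⁰)²·P^{S,S}[y₀↔y₁] ≤ …` into the sourceless form `P^{∅,∅}[(y₀↔y₁)∧𝓕_S] ≤ …` of
`stub_assembly`'s first hypothesis. [folklore] -/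
theorem sourceDoubling_of
    (hSw : ∀ (d L : ℕ) (β : ℝ), 0 ≤ β → ∀ (S : Finset (Site d)) (a b : Site d),
      S ⊆ box d L → a ∈ box d L → b ∈ box d L →
      (sourcedDoubleCurrentLaw d L β ∅ ∅).real (openConn a b ∩ traceSubcurrentEvent S) =
        isingCorr (zdGraph d) (box d L) β 0 .free S ^ 2 * (sourcedDoubleCurrentLaw d L β S S).real (openConn a b))
    (hSS : ∃ ε : ℝ, 0 < ε ∧ ε < 1 ∧ ∃ c : ℝ, 0 < c ∧
      ∀ᶠ δ in 𝓝[>] (0:ℝ), ∀ᶠ L : ℕ in atTop,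
        isingCorr (zdGraph 3) (box 3 L) (criticalBeta 3) 0 .free
              ({![0, 0, 0], ![0, ⌊ε / δ⌋, ⌊1 / δ⌋], ![⌊ε / δ⌋, ⌊ε / δ⌋, 0], ![⌊ε / δ⌋, 0, ⌊1 / δ⌋]} :
                Finset (Site 3)) ^ 2 *
            (sourcedDoubleCurrentLaw 3 L (criticalBeta 3)
                ({![0, 0, 0], ![0, ⌊ε / δ⌋, ⌊1 / δ⌋], ![⌊ε / δ⌋, ⌊ε / δ⌋, 0], ![⌊ε / δ⌋, 0, ⌊1 / δ⌋]} :
                  Finset (Site 3))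
                ({![0, 0, 0], ![0, ⌊ε / δ⌋, ⌊1 / δ⌋], ![⌊ε / δ⌋, ⌊ε / δ⌋, 0], ![⌊ε / δ⌋, 0, ⌊1 / δ⌋]} :
                  Finset (Site 3))).real
              (openConn (![0, 0, 0] : Site 3) ![0, ⌊ε / δ⌋, ⌊1 / δ⌋]) ≤
          (3 - 2 * c) *
            (isingTwoPoint (zdGraph 3) (box 3 L) (criticalBeta 3) 0 .free ![0, 0, 0] ![0, ⌊ε / δ⌋, ⌊1 / δ⌋] *
              isingTwoPoint (zdGraph 3) (box 3 L) (criticalBeta 3) 0 .free ![⌊ε / δ⌋, ⌊ε / δ⌋, 0] ![⌊ε / δ⌋, 0, ⌊1 / δ⌋]) *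
            (isingTwoPoint (zdGraph 3) (box 3 L) (criticalBeta 3) 0 .free ![0, 0, 0] ![⌊ε / δ⌋, ⌊ε / δ⌋, 0] *
              isingTwoPoint (zdGraph 3) (box 3 L) (criticalBeta 3) 0 .free ![0, ⌊ε / δ⌋, ⌊1 / δ⌋] ![⌊ε / δ⌋, 0, ⌊1 / δ⌋])) :
    ∃ ε : ℝ, 0 < ε ∧ ε < 1 ∧ ∃ c : ℝ, 0 < c ∧
      ∀ᶠ δ in 𝓝[>] (0:ℝ), ∀ᶠ L : ℕ in atTop,
        (sourcedDoubleCurrentLaw 3 L (criticalBeta 3) ∅ ∅).real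
            (openConn (![0, 0, 0] : Site 3) ![0, ⌊ε / δ⌋, ⌊1 / δ⌋] ∩
              traceSubcurrentEvent ({![0, 0, 0], ![0, ⌊ε / δ⌋, ⌊1 / δ⌋], ![⌊ε / δ⌋, ⌊ε / δ⌋, 0],
                ![⌊ε / δ⌋, 0, ⌊1 / δ⌋]} : Finset (Site 3))) ≤
          (3 - 2 * c) *
            (isingTwoPoint (zdGraph 3) (box 3 L) (criticalBeta 3) 0 .free ![0, 0, 0] ![0, ⌊ε / δ⌋, ⌊1 / δ⌋] *
              isingTwoPoint (zdGraph 3) (box 3 L) (criticalBeta 3) 0 .free ![⌊ε / δ⌋, ⌊ε / δ⌋, 0] ![⌊ε / δ⌋, 0, ⌊1 / δ⌋]) *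
            (isingTwoPoint (zdGraph 3) (box 3 L) (criticalBeta 3) 0 .free ![0, 0, 0] ![⌊ε / δ⌋, ⌊ε / δ⌋, 0] *
              isingTwoPoint (zdGraph 3) (box 3 L) (criticalBeta 3) 0 .free ![0, ⌊ε / δ⌋, ⌊1 / δ⌋] ![⌊ε / δ⌋, 0, ⌊1 / δ⌋]) := by
  obtain ⟨ε, hε0, hε1, c, hc, hev⟩ := hSS
  refine ⟨ε, hε0, hε1, c, hc, ?_⟩
  filter_upwards [hev] with δ hδ
  set S : Finset (Site 3) :=
    {![0, 0, 0], ![0, ⌊ε / δ⌋, ⌊1 / δ⌋], ![⌊ε / δ⌋, ⌊ε / δ⌋, 0], ![⌊ε / δ⌋, 0, ⌊1 / δ⌋]} with hSdef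
  filter_upwards [hδ, eventually_subset_box S] with L hL hSL
  have h0 : (![0, 0, 0] : Site 3) ∈ box 3 L := hSL (by simp [hSdef])
  have h1 : (![0, ⌊ε / δ⌋, ⌊1 / δ⌋] : Site 3) ∈ box 3 L := hSL (by simp [hSdef])
  rw [hSw 3 L (criticalBeta 3) (criticalBeta_nonneg 3) S _ _ hSL h0 h1]
  exact hL

/-! ## Composition (the four landed stubs are the imported theorems of the same names:
`stub_disjointClustersBK`, `stub_clusterCover`, `stub_disphenoidSymmetry`, `stub_assembly`) -/

/-- **The crux BY NAME**, from exactly the registered stubs (`stub_assembly` is the landed glue; its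
conclusion is `MergingFloor` unfolded, so this is a definitional re-folding). -/
theorem MergingFloor_proof : MergingFloor :=
  stub_assembly (sourceDoubling_of stub_switchObservable stub_sourceDoublingSS) stub_disjointClustersBK
    stub_clusterCover stub_disphenoidSymmetry

end Summit.CriticalPhenomena.Ising3DConformalLimit.ArmHyperscalingMergingFloorXor
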